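import Literature.Geometry.Lorentzian.ConformalChangeFour
import Literature.Geometry.Lorentzian.CoordCurvatureNormSq
import Literature.Geometry.Lorentzian.LeviCivitaCurvature
import Literature.Geometry.Lorentzian.WeylConformal
import Literature.Geometry.Riemannian.IsotropicCurvature
import Literature.Geometry.Riemannian.AlmostNonnegativeCurvatureSmoothingProofs
import HarnessLib

/-!
# The isotropic curvature of a conformal metric `g' = ψ² g` in dimension four:
# `K_iso^{ψ²g}(e') = ψ⁻² K_iso^g(ψ e') − 2 ψ⁻³ Δ_g ψ`

The four-dimensional conformal transformation law of the Micallef–Moore isotropic curvature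
`K_iso(e) = K₁₃ + K₁₄ + K₂₃ + K₂₄ − 2R₁₂₃₄` (`PseudoRiemannianMetric.isotropicCurvature`,
`Riemannian/IsotropicCurvature.lean`), companion of the scalar-curvature law
`S(ψ² g) = ψ⁻³ (S(g) ψ − 6 □_g ψ)` of `Lorentzian/ConformalChangeFour.lean` and proved by the same
road: Besse's formula for the covariant curvature tensor of a conformal metric in coordinates
(`MetricCoord.IsMetricOn.apply_riemAt_conformal`, Besse 1987, Thm. 1.159 (b):
`Rm' = c (Rm − B ⊙ G)`, `B = H − θ⊗θ + ½|θ|² G`, `θ = dc/(2c)`, `H = ∇θ`), read through the chart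
dictionary (`OpensChart.riemann_eq_riemAt`, `dalembertian_eq_lapAt`, `ChartMetricCoord.lean`) and
transported to a manifold along the inverse chart (`riemann_comap_apply`, `dalembertian_comap`).

For a `g_x`-orthonormal `4`-frame `e` the Kulkarni–Nomizu terms of the five curvature components
of `K_iso` add up to `2 Σᵢ B(eᵢ, eᵢ)`; in dimension four the frame is an orthonormal BASIS, so this
is `2 tr_G B`, and for `c = ψ²` one has `tr_G B = tr_G H + |θ|² = Δψ/ψ` (`confHess_sq`:
`H = Hess ψ/ψ − dψ⊗dψ/ψ²`, `θ = dψ/ψ`, `tr_G G = 4`). Hence (all PROVED here; no definition, no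
named fact):

* `MetricCoord.mtrAt_eq_sum_of_orthonormal` — `tr_G β = Σᵢ β(bᵢ, bᵢ)` in a `G(x)`-orthonormal basis
  (`ginv_of_orthonormal`, `CoordCurvatureNormSq.lean`);
* `MetricCoord.IsMetricOn.mtrAt_besse_sq_four` — `tr_G B = ψ⁻¹ Δ_G ψ` for `c = ψ²`, `dim E = 4`;
* `OpensChart.curvatureForm_conformalRepr` — Besse 1.159 (b) for the abstract curvature tensors of
  two metrics `g`, `g' = c g` on `U : Opens E` (any dimension, any signature);
* `OpensChart.isotropicCurvature_conformalRepr_sq_four` — on `U : Opens E`, `dim E = 4`, for a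
  `g`-orthonormal frame `e`: `K_iso^{g'}(e) = ψ² K_iso^{g}(e) − 2ψ □_g ψ` (`g' = ψ² g`);
* `PseudoRiemannianMetric.isotropicCurvature_comap` — naturality of `K_iso` under the pullback by an
  equidimensional immersion (O'Neill 1983, Ch. 3, Prop. 3.59; from `curvatureForm_comap_leviCivita`
  of `AlmostNonnegativeCurvatureSmoothingProofs.lean`; orthonormality transfers by
  `isOrthonormalFrame_comap_iff` of `WeylConformal.lean`);
* `PseudoRiemannianMetric.isotropicCurvature_smul_frame` — `K_iso(c e) = c⁴ K_iso(e)`;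
* **`PseudoRiemannianMetric.isotropicCurvature_conformal_sq_four`** — on a manifold modelled on a
  `4`-dimensional space `E`, for smooth metrics `g`, `g' = ψ² g` (`ψ > 0` smooth) and a
  `g`-orthonormal frame `e` at `x`: `K_iso^{g'}_x(e) = ψ(x)² K_iso^{g}_x(e) − 2ψ(x) □_g ψ(x)`;
* **`PseudoRiemannianMetric.isotropicCurvature_conformal_sq_four_of_isOrthonormalFrame`** — the
  same on a `g'`-orthonormal frame `e'` (so that `ψ e'` is `g`-orthonormal):
  `K_iso^{g'}_x(e') = ψ(x)⁻² K_iso^{g}_x(ψ(x) e') − 2ψ(x)⁻³ □_g ψ(x)`, for every Levi-Civita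
  connection of `g'`. Summing over the three isotropic curvatures of Hamilton's blocks this is the
  law `σ_{ψ²g} = ψ⁻³(σ_g ψ − 6Δ_g ψ)` of the modified scalar curvature
  `σ = R − 6 max(λ_max W₊, λ_max W₋) = 3 min K_iso` (Gursky–LeBrun 1998, §3; Chen–Zhu 2014, (2.8)
  at `n = 4`; Micallef–Wang 1993, §2), which is how it is consumed by the discharge of
  `Literature.Geometry.Riemannian.chenZhu2014_conformal_pic_four`.

## References

* A. L. Besse, *Einstein Manifolds*, Springer 1987, Thm. 1.159 (b). [Besse1987]
* M. Micallef, M. Wang, *Metrics with nonnegative isotropic curvature*, Duke Math. J. 72 (1993)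
  649–672, §2 (conformal change of the curvature operator on isotropic 2-planes). [MicallefWang1993]
* B.-L. Chen, X.-P. Zhu, *A conformally invariant classification theorem in four dimensions*,
  Comm. Anal. Geom. 22 (2014) 811–831, §2 (2.8), §3. [ChenZhu2014]
* B. O'Neill, *Semi-Riemannian geometry*, Academic Press 1983, Ch. 3, Prop. 3.59 (local
  isometries preserve curvature), pp. 60–61 (metric contraction). [ONeill1983]
-/

noncomputable section

set_option maxSynthPendingDepth 3

open Bundle Set Function Filter Manifold Module
open scoped Manifold ContDiff Topology

namespace Literature.Geometry.Lorentzian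

/-! ### Coordinate level: traces in an orthonormal basis; the trace of Besse's tensor for `c = ψ²` -/

namespace MetricCoord

variable {E : Type*} [NormedAddCommGroup E] [NormedSpace ℝ E]

section OrthonormalTrace

variable [FiniteDimensional ℝ E] {G : E → E →L[ℝ] E →L[ℝ] ℝ} {x : E} {ι : Type*} [Fintype ι]
  [DecidableEq ι]

/-- **The metric trace in a `G(x)`-orthonormal basis**: `tr_G β = Σᵢ β(bᵢ, bᵢ)` (O'Neill 1983,
Ch. 3, pp. 60–61: `C(β) = gⁱʲ βᵢⱼ` with `gⁱʲ = δⁱʲ`). [cite: ONeill1983, Ch. 3, pp. 60–61] -/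
theorem mtrAt_eq_sum_of_orthonormal (hx : (G x).IsInvertible) (b : Module.Basis ι ℝ E)
    (hb : ∀ i j, G x (b i) (b j) = if i = j then 1 else 0) (β : E →L[ℝ] E →L[ℝ] ℝ) :
    mtrAt G x β = ∑ i, β (b i) (b i) := by
  rw [mtrAt_eq_sum b]
  exact Finset.sum_congr rfl fun i _ ↦
    sum_ginv_mul_of_orthonormal b hb hx (fun j ↦ β (b i) (b j)) i

omit [FiniteDimensional ℝ E] [Fintype ι] in
/-- A `G(x)`-orthonormal family is linearly independent. [folklore] -/
theorem linearIndependent_of_orthonormal {e : ι → E}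
    (he : ∀ i j, G x (e i) (e j) = if i = j then 1 else 0) : LinearIndependent ℝ e := by
  rw [linearIndependent_iff']
  intro s c hc i hi
  have h := congrArg (fun v ↦ G x v (e i)) hc
  simp only [map_sum, map_smul, FunLike.coe_sum, Finset.sum_apply, FunLike.coe_smul,
    Pi.smul_apply, smul_eq_mul, map_zero, _root_.zero_apply] at h
  simp only [he, mul_ite, mul_one, mul_zero, Finset.sum_ite_eq', hi, if_true] at h
  exact h

end OrthonormalTrace

section BesseTraceFour

variable [FiniteDimensional ℝ E] [CompleteSpace E] {G : E → E →L[ℝ] E →L[ℝ] ℝ} {u : E → ℝ}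
  {V : Set E} {x : E}

omit [CompleteSpace E] in
/-- **The trace of Besse's tensor for `c = ψ²` in dimension four.** With `θ = dc/(2c) = dψ/ψ`,
`H = ∇θ = Hess ψ/ψ − dψ⊗dψ/ψ²` (`confHess_sq`) and `B = H − θ⊗θ + ½|θ|²G` (the symmetric form of
Besse 1987, Thm. 1.159 (b)), `ψ tr_G B = Δψ − |dψ|²/ψ − |dψ|²/ψ + ½ (|dψ|²/ψ) · 4 = Δ_G ψ` when
`dim E = 4`. [cite: Besse1987, Thm. 1.159 (b)] -/
theorem IsMetricOn.mtrAt_besse_sq_four (hG : IsMetricOn G V) (hu : ContDiffOn ℝ ∞ u V)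
    (hu0 : ∀ y ∈ V, u y ≠ 0) (hx : x ∈ V) (h4 : finrank ℝ E = 4) :
    u x * mtrAt G x (confHess G (fun z ↦ u z ^ 2) x
        - (confForm (fun z ↦ u z ^ 2) x).smulRight (confForm (fun z ↦ u z ^ 2) x)
        + (1 / 2 * confForm (fun z ↦ u z ^ 2) x (confVec G (fun z ↦ u z ^ 2) x)) • G x) =
      lapAt G u x := by
  have hi := hG.isInvertible x hx
  have hux := hu0 x hx
  have hθ : confForm (fun z ↦ u z ^ 2) x = (u x)⁻¹ • fderiv ℝ u x :=
    confForm_sq (hG.differentiableAt_of_contDiffOn hu hx) hux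
  rw [mtrAt_add, mtrAt_sub, hG.confHess_sq hu hu0 hx, mtrAt_sub, mtrAt_smul, mtrAt_smul,
    mtrAt_smulRight, mtrAt_smul, mtrAt_self hi, confVec, hθ, mtrAt_smulRight, ← lapAt, h4]
  simp only [map_smul, FunLike.coe_smul, Pi.smul_apply, smul_eq_mul, Nat.cast_ofNat]
  field_simp
  ring

end BesseTraceFour

end MetricCoord

/-! ### Chart level: Besse 1.159 (b) for the abstract curvature tensors; the isotropic curvature -/

namespace OpensChart

variable {E : Type*} [NormedAddCommGroup E] [NormedSpace ℝ E] [FiniteDimensional ℝ E]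
  [CompleteSpace E] {U : TopologicalSpace.Opens E}
  {g g' : PseudoRiemannianMetric 𝓘(ℝ, E) ∞ E (TangentSpace 𝓘(ℝ, E) : U → Type _)}
  {G : E → E →L[ℝ] E →L[ℝ] ℝ} (hG : ∀ y : U, g.val y = G y) {c : E → ℝ}
  (hGc : ∀ y : U, g'.val y = (c y) • G y)

include hG hGc in
/-- **Besse 1987, Thm. 1.159 (b), for the abstract curvature tensors in a chart.** For smooth
metrics `g`, `g' = c g` on `U : Opens E` (`c` smooth and nonvanishing on `U`), with
`θ = dc/(2c)`, `T = θ♯`, `H = ∇θ` (`confHess`) and `B = H − θ⊗θ + ½|θ|²G`: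
`Rm'(X,Y,Z,W) = c (Rm(X,Y,Z,W) − (B ⊙ G)(X,Y,Z,W))` with
`(B ⊙ G)(X,Y,Z,W) = B(X,W)G(Y,Z) + B(Y,Z)G(X,W) − B(X,Z)G(Y,W) − B(Y,W)G(X,Z)`, where
`Rm(X,Y,Z,W) = g(R(X,Y)Z, W)` (`curvatureForm` of the Levi-Civita connections).
[cite: Besse1987, Thm. 1.159 (b)] -/
theorem curvatureForm_conformalRepr [g.HasLeviCivita] [g'.HasLeviCivita]
    (hc : ContDiffOn ℝ ∞ c (U : Set E)) (hc0 : ∀ y ∈ (U : Set E), c y ≠ 0) (x : U)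
    (X Y Z W : E) :
    g'.curvatureForm g'.leviCivita x X Y Z W =
      c x * (g.curvatureForm g.leviCivita x X Y Z W
        - ((MetricCoord.confHess G c x X W - MetricCoord.confForm c x X * MetricCoord.confForm c x W
              + 1 / 2 * MetricCoord.confForm c x (MetricCoord.confVec G c x) * G x X W) * G x Y Z
          + (MetricCoord.confHess G c x Y Z - MetricCoord.confForm c x Y * MetricCoord.confForm c x Z
              + 1 / 2 * MetricCoord.confForm c x (MetricCoord.confVec G c x) * G x Y Z) * G x X W
          - (MetricCoord.confHess G c x X Z - MetricCoord.confForm c x X * MetricCoord.confForm c x Z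
              + 1 / 2 * MetricCoord.confForm c x (MetricCoord.confVec G c x) * G x X Z) * G x Y W
          - (MetricCoord.confHess G c x Y W - MetricCoord.confForm c x Y * MetricCoord.confForm c x W
              + 1 / 2 * MetricCoord.confForm c x (MetricCoord.confVec G c x) * G x Y W) * G x X Z)) := by
  have hmet : MetricCoord.IsMetricOn G (U : Set E) := isMetricOn_repr hG
  change g'.val x (g'.riemann x X Y Z) W = c x * (g.val x (g.riemann x X Y Z) W - _)
  rw [riemann_eq_riemAt (G := fun y ↦ c y • G y) hGc x, riemann_eq_riemAt hG x, hGc x, hG x]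
  change c x * G x (MetricCoord.riemAt (fun y ↦ c y • G y) x X Y Z) W = _
  rw [hmet.apply_riemAt_conformal hc hc0 x.2 X Y Z W]
  rfl

variable {ψ : E → ℝ} (hG' : ∀ y : U, g'.val y = (ψ y ^ 2) • G y)

include hG hG' in
/-- **The isotropic curvature of `ψ² g` on a chart of a `4`-dimensional space**, for a
`g_x`-orthonormal `4`-frame `e` (an orthonormal basis of `E`):
`K_iso^{g'}(e) = ψ² K_iso^{g}(e) − 2ψ □_g ψ`. The Kulkarni–Nomizu terms of
`curvatureForm_conformalRepr` contribute `B(eᵢ,eᵢ) + B(eⱼ,eⱼ)` to each sectional term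
`Rm(eᵢ,eⱼ,eⱼ,eᵢ)` and nothing to `Rm(e₁,e₂,e₄,e₃)`, in total `2 tr_G B = 2ψ⁻¹ Δ_G ψ`
(`mtrAt_besse_sq_four`). [cite: Besse1987, Thm. 1.159 (b)] [cite: MicallefWang1993, §2] -/
theorem isotropicCurvature_conformalRepr_sq_four [g.HasLeviCivita] [g'.HasLeviCivita]
    (h4 : finrank ℝ E = 4) (hψ : ContDiffOn ℝ ∞ ψ (U : Set E))
    (hψ0 : ∀ y ∈ (U : Set E), ψ y ≠ 0) (x : U) {e : Fin 4 → E}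
    (he : g.IsOrthonormalFrame x (e : Fin 4 → TangentSpace 𝓘(ℝ, E) x)) :
    g'.isotropicCurvature g'.leviCivita x e =
      ψ x ^ 2 * g.isotropicCurvature g.leviCivita x e
        - 2 * ψ x * g.dalembertian (fun y : U ↦ ψ y) x := by
  have hmet : MetricCoord.IsMetricOn G (U : Set E) := isMetricOn_repr hG
  have hi : (G x).IsInvertible := hmet.isInvertible x x.2
  have hc : ContDiffOn ℝ ∞ (fun z ↦ ψ z ^ 2) (U : Set E) := hψ.pow 2
  have hc0 : ∀ y ∈ (U : Set E), ψ y ^ 2 ≠ 0 := fun y hy ↦ pow_ne_zero 2 (hψ0 y hy)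
  -- orthonormality in coordinates
  have hGe : ∀ i j, G x (e i) (e j) = if i = j then 1 else 0 := by
    intro i j
    by_cases hij : i = j
    · subst hij
      have h1 := he.1 i
      rw [hG x] at h1
      rw [if_pos rfl]
      exact h1
    · have h0 := he.2 i j hij
      rw [hG x] at h0
      rw [if_neg hij]
      exact h0
  have hd : ∀ i, G x (e i) (e i) = 1 := fun i ↦ by simpa using hGe i i
  have ho : ∀ i j, i ≠ j → G x (e i) (e j) = 0 := fun i j hij ↦ by simpa [hij] using hGe i j
  -- the frame is an orthonormal basis; the trace of Besse's tensor
  have hli : LinearIndependent ℝ e := MetricCoord.linearIndependent_of_orthonormal hGe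
  have hcard : Fintype.card (Fin 4) = finrank ℝ E := by rw [h4, Fintype.card_fin]
  set b : Module.Basis (Fin 4) ℝ E := basisOfLinearIndependentOfCardEqFinrank hli hcard with hb
  have hbe : ∀ i, b i = e i := fun i ↦ by
    rw [hb, coe_basisOfLinearIndependentOfCardEqFinrank]
  have hb' : ∀ i j, G x (b i) (b j) = if i = j then 1 else 0 := fun i j ↦ by
    rw [hbe, hbe]; exact hGe i j
  have htr := hmet.mtrAt_besse_sq_four hψ hψ0 x.2 h4
  rw [MetricCoord.mtrAt_eq_sum_of_orthonormal hi b hb', Fin.sum_univ_four, hbe, hbe, hbe, hbe]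
    at htr
  simp only [_root_.add_apply, _root_.sub_apply, ContinuousLinearMap.smulRight_apply,
    FunLike.coe_smul, Pi.smul_apply, smul_eq_mul, hd, mul_one] at htr
  -- the Laplacian in the chart
  have hψx : ContDiffAt ℝ 2 ψ x :=
    (hψ.contDiffAt (U.2.mem_nhds x.2)).of_le (WithTop.coe_le_coe.mpr le_top)
  rw [dalembertian_eq_lapAt hG x (f := fun y : U ↦ ψ y) (Φ := ψ) (fun _ ↦ rfl) hψx]
  -- expand the five curvature components
  simp only [PseudoRiemannianMetric.isotropicCurvature,
    curvatureForm_conformalRepr hG hG' hc hc0 x, hd,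
    ho 0 2 (by decide), ho 0 3 (by decide), ho 1 2 (by decide), ho 1 3 (by decide),
    ho 2 0 (by decide), ho 2 1 (by decide), ho 3 0 (by decide), ho 3 1 (by decide)]
  linear_combination (-(2 : ℝ) * ψ x) * htr

end OpensChart

/-! ### Naturality of the isotropic curvature under pullback -/

namespace PseudoRiemannianMetric

section Comap

variable {E : Type*} [NormedAddCommGroup E] [NormedSpace ℝ E] {H : Type*} [TopologicalSpace H]
  {I : ModelWithCorners ℝ E H} {M : Type*} [TopologicalSpace M] [ChartedSpace H M]
  [IsManifold I ∞ M]
  {E' : Type*} [NormedAddCommGroup E'] [NormedSpace ℝ E'] {H' : Type*} [TopologicalSpace H']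
  {I' : ModelWithCorners ℝ E' H'} {N : Type*} [TopologicalSpace N] [ChartedSpace H' N]
  [IsManifold I' ∞ N]
  [FiniteDimensional ℝ E] [FiniteDimensional ℝ E'] [CompleteSpace E] [CompleteSpace E']
  (g : PseudoRiemannianMetric I ∞ E (TangentSpace I : M → Type _))
  {Φ : N → M} (hpb : contMDiff_pullbackBilin I M I' N ∞) (hΦ : ContMDiff I' I (∞ + 1) Φ)
  (hΦ' : ∀ u, Function.Injective (mfderiv I' I Φ u))
  (hdim : Module.finrank ℝ E' = Module.finrank ℝ E)

include hΦ' in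
/-- **Naturality of the isotropic curvature**: `K_iso^{Φ^*g}_u(e) = K_iso^g_{Φ u}(dΦ e)`.
[cite: ONeill1983, Ch. 3, Prop. 3.59] -/
theorem isotropicCurvature_comap [g.HasLeviCivita] [(g.comap hpb Φ hΦ hΦ' hdim).HasLeviCivita]
    (u : N) (e : Fin 4 → TangentSpace I' u) :
    (g.comap hpb Φ hΦ hΦ' hdim).isotropicCurvature (g.comap hpb Φ hΦ hΦ' hdim).leviCivita u e =
      g.isotropicCurvature g.leviCivita (Φ u) (fun i ↦ mfderiv I' I Φ u (e i)) := by
  simp only [isotropicCurvature, g.curvatureForm_comap_leviCivita hpb hΦ hΦ' hdim u]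

end Comap

/-! ### Homogeneity of the isotropic curvature in the frame -/

section Smul

variable {E : Type*} [NormedAddCommGroup E] [NormedSpace ℝ E] {H : Type*} [TopologicalSpace H]
  {I : ModelWithCorners ℝ E H} {M : Type*} [TopologicalSpace M] [ChartedSpace H M]
  [IsManifold I ∞ M] {n : ℕ∞ω}
  (g : PseudoRiemannianMetric I n E (TangentSpace I : M → Type _))
  (cov : CovariantDerivative I E (TangentSpace I : M → Type _))

/-- `K_iso(c e₁, c e₂, c e₃, c e₄) = c⁴ K_iso(e₁, e₂, e₃, e₄)` (each curvature component is
`4`-linear in the frame). [folklore] -/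
theorem isotropicCurvature_smul_frame (x : M) (c : ℝ) (e : Fin 4 → TangentSpace I x) :
    g.isotropicCurvature cov x (fun i ↦ c • e i) = c ^ 4 * g.isotropicCurvature cov x e := by
  simp only [isotropicCurvature, curvatureForm, map_smul, FunLike.coe_smul,
    Pi.smul_apply, smul_eq_mul]
  ring

/-- An orthonormal frame of `c² g` rescaled by `c` is an orthonormal frame of `g`. [folklore] -/
theorem IsOrthonormalFrame.smul_of_conformal {ι : Type*}
    {g' : PseudoRiemannianMetric I n E (TangentSpace I : M → Type _)} {x : M} {c : ℝ}
    (hgg' : ∀ v w : TangentSpace I x, g'.val x v w = c ^ 2 * g.val x v w)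
    {e : ι → TangentSpace I x} (he : g'.IsOrthonormalFrame x e) :
    g.IsOrthonormalFrame x (fun i ↦ c • e i) := by
  refine ⟨fun i ↦ ?_, fun i j hij ↦ ?_⟩
  · have h := he.1 i
    rw [hgg'] at h
    simp only [map_smul, FunLike.coe_smul, Pi.smul_apply, smul_eq_mul]
    linear_combination h
  · have h := he.2 i j hij
    rw [hgg'] at h
    simp only [map_smul, FunLike.coe_smul, Pi.smul_apply, smul_eq_mul]
    have hc : c ^ 2 * g.val x (e i) (e j) = 0 := h
    rcases mul_eq_zero.1 hc with hc | hc
    · rw [pow_eq_zero_iff two_ne_zero] at hc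
      simp [hc]
    · rw [hc, mul_zero, mul_zero]

/-- The isotropic curvature of a frame is the same for every Levi-Civita connection of `g`
(`IsLeviCivita.curvature_eq_riemann`). [cite: ONeill1983, Ch. 3, Thm. 3.11 and Lemma 3.35] -/
theorem IsLeviCivita.isotropicCurvature_eq [Fact (1 ≤ n)] [FiniteDimensional ℝ E] [CompleteSpace E]
    [g.HasLeviCivita] {cov} (h : g.IsLeviCivita cov) (hn : 2 ≤ n) (x : M)
    (e : Fin 4 → TangentSpace I x) :
    g.isotropicCurvature cov x e = g.isotropicCurvature g.leviCivita x e := by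
  simp only [isotropicCurvature, curvatureForm, h.curvature_eq_riemann hn x]
  rfl

end Smul

/-! ### The law on a `4`-manifold -/

/-- **The conformal transformation law of the isotropic curvature in dimension four.** Let `X`
be a manifold modelled on a `4`-dimensional space `E` (charts into `E` itself), `g` and `g'`
smooth metrics with their Levi-Civita connections, `ψ` a smooth positive function with
`g' = ψ² g`, and `e` a `g_x`-orthonormal `4`-frame. Then
`K_iso^{g'}_x(e) = ψ(x)² K_iso^{g}_x(e) − 2 ψ(x) □_g ψ(x)`, `□_g = tr_g Hess` — Besse 1987,
Thm. 1.159 (b) contracted over the totally isotropic 2-plane `span{e₁ + ie₂, e₃ + ie₄}`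
(Micallef–Wang 1993, §2). Proof: pull both metrics back along the inverse chart at `x`
(`isotropicCurvature_comap`, `dalembertian_comap`), where the law is
`OpensChart.isotropicCurvature_conformalRepr_sq_four`. [cite: Besse1987, Thm. 1.159 (b)]
[cite: MicallefWang1993, §2] -/
theorem isotropicCurvature_conformal_sq_four {E : Type*} [NormedAddCommGroup E] [NormedSpace ℝ E]
    [FiniteDimensional ℝ E] [CompleteSpace E] (h4 : finrank ℝ E = 4)
    {X : Type*} [TopologicalSpace X] [ChartedSpace E X] [IsManifold 𝓘(ℝ, E) ∞ X]
    (g g' : PseudoRiemannianMetric 𝓘(ℝ, E) ∞ E (TangentSpace 𝓘(ℝ, E) : X → Type _))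
    [g.HasLeviCivita] [g'.HasLeviCivita] {ψ : X → ℝ}
    (hψ : ContMDiff 𝓘(ℝ, E) 𝓘(ℝ) ∞ ψ) (hpos : ∀ x : X, 0 < ψ x)
    (hgg' : ∀ (x : X) (v w : TangentSpace 𝓘(ℝ, E) x), g'.val x v w = ψ x ^ 2 * g.val x v w)
    (x : X) {e : Fin 4 → TangentSpace 𝓘(ℝ, E) x} (he : g.IsOrthonormalFrame x e) :
    g'.isotropicCurvature g'.leviCivita x e =
      ψ x ^ 2 * g.isotropicCurvature g.leviCivita x e - 2 * ψ x * g.dalembertian ψ x := by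
  -- the inverse chart at `x`
  set U : TopologicalSpace.Opens E := ⟨(chartAt E x).target, (chartAt E x).open_target⟩ with hU
  set Φ : U → X := fun u ↦ (chartAt E x).symm u with hΦdef
  have hΦ : ContMDiff 𝓘(ℝ, E) 𝓘(ℝ, E) (∞ + 1) Φ := ChartInverseSelf.contMDiff_symm x
  have hΦ' : ∀ u, Function.Injective (mfderiv 𝓘(ℝ, E) 𝓘(ℝ, E) Φ u) :=
    ChartInverseSelf.injective_mfderiv_symm x
  have hdim : Module.finrank ℝ E = Module.finrank ℝ E := rfl
  have hpb : contMDiff_pullbackBilin 𝓘(ℝ, E) X 𝓘(ℝ, E) U ∞ := contMDiff_pullbackBilin_holds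
  set u₀ : U := ⟨chartAt E x x, (chartAt E x).map_source (mem_chart_source E x)⟩ with hu₀
  have hx : Φ u₀ = x := (chartAt E x).left_inv (mem_chart_source E x)
  -- the pulled-back metrics on `U`
  set gU := g.comap hpb Φ hΦ hΦ' hdim with hgU
  set gU' := g'.comap hpb Φ hΦ hΦ' hdim with hgU'
  haveI : gU.HasLeviCivita := gU.hasLeviCivita
  haveI : gU'.HasLeviCivita := gU'.hasLeviCivita
  -- move the base point to `Φ u₀` and pull the frame back
  rw [← hx] at he ⊢
  set L := mfderivEquivOfInjective (I := 𝓘(ℝ, E)) (I' := 𝓘(ℝ, E)) Φ u₀ (hΦ' u₀) hdim with hL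
  set eU : Fin 4 → TangentSpace 𝓘(ℝ, E) u₀ := fun i ↦ L.symm (e i) with heU
  have hLe : (fun i ↦ mfderiv 𝓘(ℝ, E) 𝓘(ℝ, E) Φ u₀ (eU i)) = e := funext fun i ↦
    mfderiv_mfderivEquivOfInjective_symm (I := 𝓘(ℝ, E)) (I' := 𝓘(ℝ, E)) Φ u₀ (hΦ' u₀) hdim (e i)
  have hK' : g'.isotropicCurvature g'.leviCivita (Φ u₀) e =
      gU'.isotropicCurvature gU'.leviCivita u₀ eU := by
    rw [g'.isotropicCurvature_comap hpb hΦ hΦ' hdim u₀ eU, hLe]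
  have hK : g.isotropicCurvature g.leviCivita (Φ u₀) e =
      gU.isotropicCurvature gU.leviCivita u₀ eU := by
    rw [g.isotropicCurvature_comap hpb hΦ hΦ' hdim u₀ eU, hLe]
  have heUon : gU.IsOrthonormalFrame u₀ eU := by
    rw [g.isOrthonormalFrame_comap_iff hpb hΦ hΦ' hdim u₀ eU, hLe]
    exact he
  have hψ2 : ContMDiffAt 𝓘(ℝ, E) 𝓘(ℝ) 2 ψ (Φ u₀) := (hψ.of_le (WithTop.coe_le_coe.mpr le_top)) _
  rw [hK', hK, ← g.dalembertian_comap hpb hΦ hΦ' hdim hψ2]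
  -- representatives on `E`
  set G : E → E →L[ℝ] E →L[ℝ] ℝ := Function.extend (Subtype.val : U → E)
    (fun y : U ↦ (gU.val y : E →L[ℝ] E →L[ℝ] ℝ)) (fun _ ↦ 0) with hGdef
  set ψE : E → ℝ := fun y ↦ ψ ((chartAt E x).symm y) with hψEdef
  have hG : ∀ y : U, gU.val y = G y := fun y ↦ by
    rw [hGdef, Subtype.val_injective.extend_apply]
  have hψy : ∀ y : U, ψE y = ψ (Φ y) := fun y ↦ rfl
  have hG' : ∀ y : U, gU'.val y = (ψE y ^ 2) • G y := by
    intro y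
    ext v w
    change g'.val (Φ y) (mfderiv 𝓘(ℝ, E) 𝓘(ℝ, E) Φ y v) (mfderiv 𝓘(ℝ, E) 𝓘(ℝ, E) Φ y w) =
      ψE y ^ 2 * G y v w
    rw [hgg', ← hG y]
    rfl
  have hψs : ContDiffOn ℝ ∞ ψE (U : Set E) := fun y hy ↦
    (ChartInverseSelf.contDiffAt_comp_symm x hψ hy).contDiffWithinAt
  have hψ0 : ∀ y ∈ (U : Set E), ψE y ≠ 0 := fun y _ ↦ (hpos _).ne'
  -- the chart computation
  have key := OpensChart.isotropicCurvature_conformalRepr_sq_four hG (g' := gU') hG' h4 hψs hψ0 u₀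
    (e := eU) heUon
  have hfun : (fun y : U ↦ ψE y) = ψ ∘ Φ := funext fun y ↦ hψy y
  rw [hfun, hψy] at key
  exact key

/-- **The law on a `g'`-orthonormal frame, for every Levi-Civita connection of `g' = ψ² g`**
(dimension four): if `e'` is `g'_x`-orthonormal then `ψ(x) e'` is `g_x`-orthonormal and
`K_iso^{g'}_x(e') = ψ(x)⁻² K_iso^{g}_x(ψ(x) e') − 2 ψ(x)⁻³ □_g ψ(x)`. With
`σ = 3 min_e K_iso(e)` this is Gursky–LeBrun's / Chen–Zhu's `σ_{u²g} = u⁻³(σ_g u − 6Δ_g u)`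
(Chen–Zhu 2014, (2.8) at `n = 4`). [cite: Besse1987, Thm. 1.159 (b)] [cite: ChenZhu2014, §2 (2.8)]
[cite: MicallefWang1993, §2] -/
theorem isotropicCurvature_conformal_sq_four_of_isOrthonormalFrame {E : Type*}
    [NormedAddCommGroup E] [NormedSpace ℝ E] [FiniteDimensional ℝ E] [CompleteSpace E]
    (h4 : finrank ℝ E = 4)
    {X : Type*} [TopologicalSpace X] [ChartedSpace E X] [IsManifold 𝓘(ℝ, E) ∞ X]
    (g g' : PseudoRiemannianMetric 𝓘(ℝ, E) ∞ E (TangentSpace 𝓘(ℝ, E) : X → Type _))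
    [g.HasLeviCivita] [g'.HasLeviCivita] {ψ : X → ℝ}
    (hψ : ContMDiff 𝓘(ℝ, E) 𝓘(ℝ) ∞ ψ) (hpos : ∀ x : X, 0 < ψ x)
    (hgg' : ∀ (x : X) (v w : TangentSpace 𝓘(ℝ, E) x), g'.val x v w = ψ x ^ 2 * g.val x v w)
    {cov' : CovariantDerivative 𝓘(ℝ, E) E (TangentSpace 𝓘(ℝ, E) : X → Type _)}
    (hcov' : g'.IsLeviCivita cov')
    (x : X) {e' : Fin 4 → TangentSpace 𝓘(ℝ, E) x} (he' : g'.IsOrthonormalFrame x e') :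
    g'.isotropicCurvature cov' x e' =
      (ψ x ^ 2)⁻¹ * g.isotropicCurvature g.leviCivita x (fun i ↦ ψ x • e' i)
        - 2 * (ψ x ^ 3)⁻¹ * g.dalembertian ψ x := by
  have hψx : ψ x ≠ 0 := (hpos x).ne'
  have he : g.IsOrthonormalFrame x (fun i ↦ ψ x • e' i) :=
    IsOrthonormalFrame.smul_of_conformal g (hgg' x) he'
  have key := isotropicCurvature_conformal_sq_four h4 g g' hψ hpos hgg' x he
  rw [g'.isotropicCurvature_smul_frame g'.leviCivita x (ψ x) e'] at key
  have h2 : (2 : ℕ∞ω) ≤ ∞ := WithTop.coe_le_coe.mpr le_top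
  rw [hcov'.isotropicCurvature_eq g' h2 x e']
  have h4ne : ψ x ^ 4 ≠ 0 := pow_ne_zero 4 hψx
  have hsolve : g'.isotropicCurvature g'.leviCivita x e' =
      (ψ x ^ 4)⁻¹ * (ψ x ^ 2 * g.isotropicCurvature g.leviCivita x (fun i ↦ ψ x • e' i)
        - 2 * ψ x * g.dalembertian ψ x) := by
    rw [← key, ← mul_assoc, inv_mul_cancel₀ h4ne, one_mul]
  rw [hsolve]
  field_simp

end PseudoRiemannianMetric

end Literature.Geometry.Lorentzian

end
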